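import Literature.Topology.FourManifolds.RankOneFoldPoint
import HarnessLib

/-!
# The `fold` clause at a point of a map between manifolds, from rank-one coordinates

Topic `Literature/Topology/FourManifolds`.  The manifold form of the criterion of
`RankOneFoldPoint.lean`: for a map `f : X → B` from a 4-manifold to a surface (charted on
`ℝ⁴`, `ℝ²`), smooth charts `Φ₀` at `p` and `Ψ₀` at `f p`, and rank-one coordinates of the local
representative `Ψ₀ ∘ f ∘ Φ₀⁻¹` at `Φ₀ p` in which the fibre gradient vanishes with nondegenerate
indefinite fibre Hessian, the point `p` carries the charts demanded by the clause
`IsSimplifiedBrokenLefschetzFibration.fold` (Baykur–Saeki 2017, §2.1; Hayano 2011,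
Def. 2.1 (4)).  Composition of `hasIndefiniteFoldChart_of_rankOneChart` with
`exists_foldChart_of_hasIndefiniteFoldChart` (`IndefiniteFoldChartTransport.lean`).  PROVED;
no named fact.

## References

* R. İ. Baykur, O. Saeki, *Simplifying indefinite fibrations on 4-manifolds*, arXiv:1705.11169
  (Trans. AMS 376, 2023), §2.1. [BaykurSaeki2017]
* K. Hayano, *On genus-1 simplified broken Lefschetz fibrations*, Algebr. Geom. Topol. 11
  (2011), Def. 2.1 (4). [Hayano2011]
-/

noncomputable section

-- Instance search through the tower `E →L[ℝ] E →L[ℝ] ℝ` needs one more level of pending depth.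
set_option maxSynthPendingDepth 2

open Set Function Filter
open scoped Manifold Topology ContDiff

namespace Literature.Topology.FourManifolds

variable {X : Type*} [TopologicalSpace X] [ChartedSpace (EuclideanSpace ℝ (Fin 4)) X]
  {B : Type*} [TopologicalSpace B] [ChartedSpace (EuclideanSpace ℝ (Fin 2)) B]

/-- **The `fold` clause from rank-one coordinates, on a manifold.**  Let `f : X → B`, `Φ₀` a
smooth chart of `X` at `p` and `Ψ₀` one of `B` with `f (Φ₀.source) ⊆ Ψ₀.source` (both `C^∞`
with `C^∞` inverses), and let the local representative `G = Ψ₀ ∘ f ∘ Φ₀⁻¹ : ℝ⁴ → ℝ²` admit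
rank-one coordinates `φ`, `ψ`, `f̃` at `Φ₀ p` (`ψ (G y) = ((φ y)₀, f̃ (φ y))`, `φ (Φ₀ p) = 0`) in
which the fibre gradient of `f̃ ∘ unfibre` vanishes at `0` with nondegenerate indefinite fibre
Hessian.  Then `f` has at `p` centred charts `φ'`, `ψ'` with
`ψ' (f q) = ((φ' q)₀, (φ' q)₁² + (φ' q)₂² - (φ' q)₃²)` — the clause
`IsSimplifiedBrokenLefschetzFibration.fold` at `p`. [cite: BaykurSaeki2017, §2.1] -/
theorem exists_foldChart_of_rankOneChart {f : X → B}
    {Φ₀ : OpenPartialHomeomorph X (EuclideanSpace ℝ (Fin 4))}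
    {Ψ₀ : OpenPartialHomeomorph B (EuclideanSpace ℝ (Fin 2))}
    (hΦ₀ : ContMDiffOn (𝓡 4) (𝓡 4) ∞ Φ₀ Φ₀.source)
    (hΦ₀s : ContMDiffOn (𝓡 4) (𝓡 4) ∞ Φ₀.symm Φ₀.target)
    (hΨ₀ : ContMDiffOn (𝓡 2) (𝓡 2) ∞ Ψ₀ Ψ₀.source)
    (hΨ₀s : ContMDiffOn (𝓡 2) (𝓡 2) ∞ Ψ₀.symm Ψ₀.target)
    (hmaps₀ : MapsTo f Φ₀.source Ψ₀.source) {p : X} (hp : p ∈ Φ₀.source)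
    {φ : OpenPartialHomeomorph (EuclideanSpace ℝ (Fin 4)) (EuclideanSpace ℝ (Fin 4))}
    {ψ : OpenPartialHomeomorph (EuclideanSpace ℝ (Fin 2)) (EuclideanSpace ℝ (Fin 2))}
    {g : EuclideanSpace ℝ (Fin 4) → ℝ} (hpφ : Φ₀ p ∈ φ.source) (hp0 : φ (Φ₀ p) = 0)
    (hmaps : MapsTo (Ψ₀ ∘ f ∘ Φ₀.symm) φ.source ψ.source)
    (hφ : ContDiffOn ℝ ∞ φ φ.source) (hφs : ContDiffOn ℝ ∞ φ.symm φ.target)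
    (hψ : ContDiffOn ℝ ∞ ψ ψ.source) (hψs : ContDiffOn ℝ ∞ ψ.symm ψ.target)
    (hg : ContDiffOn ℝ ∞ g φ.target)
    (hid : ∀ y ∈ φ.source, ψ ((Ψ₀ ∘ f ∘ Φ₀.symm) y) 0 = φ y 0 ∧
      ψ ((Ψ₀ ∘ f ∘ Φ₀.symm) y) 1 = g (φ y))
    (hcrit : fibreGrad (g ∘ unfibre) (0, 0) = 0)
    (hH : ∀ a : EuclideanSpace ℝ (Fin 3),
      (∀ b, fibreHessian (g ∘ unfibre) (0, 0) a b = 0) → a = 0)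
    (hneg : ∃ a : EuclideanSpace ℝ (Fin 3), fibreHessian (g ∘ unfibre) (0, 0) a a < 0)
    (hpos : ∃ b : EuclideanSpace ℝ (Fin 3), 0 < fibreHessian (g ∘ unfibre) (0, 0) b b) :
    ∃ (φ' : OpenPartialHomeomorph X (EuclideanSpace ℝ (Fin 4)))
      (ψ' : OpenPartialHomeomorph B (EuclideanSpace ℝ (Fin 2))),
      p ∈ φ'.source ∧ φ' p = 0 ∧ MapsTo f φ'.source ψ'.source ∧
      ContMDiffOn (𝓡 4) (𝓡 4) ∞ φ' φ'.source ∧ ContMDiffOn (𝓡 4) (𝓡 4) ∞ φ'.symm φ'.target ∧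
      ContMDiffOn (𝓡 2) (𝓡 2) ∞ ψ' ψ'.source ∧ ContMDiffOn (𝓡 2) (𝓡 2) ∞ ψ'.symm ψ'.target ∧
      ∀ q ∈ φ'.source, (ψ' (f q)) 0 = (φ' q) 0 ∧
        (ψ' (f q)) 1 = (φ' q) 1 ^ 2 + (φ' q) 2 ^ 2 - (φ' q) 3 ^ 2 :=
  exists_foldChart_of_hasIndefiniteFoldChart hΦ₀ hΦ₀s hΨ₀ hΨ₀s hmaps₀ hp
    (hasIndefiniteFoldChart_of_rankOneChart hpφ hp0 hmaps hφ hφs hψ hψs hg hid hcrit hH hneg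
      hpos)

end Literature.Topology.FourManifolds

end
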